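import Summits.BirchSwinnertonDyer.Rank1Residual.GaloisImage.KolyvaginStalkExistence
import HarnessLib

/-!
# The classes `κ_n` built from the volume system, and `κ_n ∈ H¹_{𝓕(n)}(K, M)` (cell `b2b-bsdres`,
# team n1011, ROUTE-1 item R1-56 "S24(1) @ m = 1 in the kernel", row T-R1-56-S, FILE D3 = K4
# EXISTENCE, the classes)

HONEST FRAMING (verbatim for the cell): research route; prove what is provable now; no claim beyond
stated classes; nothing booked; no mark / label moved.  TOOL theorems about Kolyvagin systems of a
finite Galois module at the residual level `m = 1` (one auxiliary definition `kappa`); no named fact,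
no conjecture node.  Setting = p11's R1-16 files + FILES A / D1 / D2 of the row.

## What (Mazur–Rubin, JTNB 28 (2016) Def. 8.1, Prop. 8.3 and Lemma 8.2 at rank one over a field)

With the volume system `vol` of `KolyvaginStalkExistence.lean` (base `N₀`, `ε₀`):
`kappa n := (−1)^{#n} · cross_{W(n ∪ N₀)} (vol (n ∪ N₀)) (φ_n)`, `φ_n(𝔮) = f_𝔮` for `𝔮 ∈ n` and
`t_𝔮` for `𝔮 ∉ n` (and `kappa n := 0` off the levels).  Then:
* `kappa_mem_selmerGroup`: `κ_n ∈ H¹_{𝓕(n)}(K, M)` — the cross product is killed by every `φ_n(𝔮)`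
  (Mazur–Rubin Def. 8.1: `Π_n` lands in `H¹_{𝓕(n)}`);
* the sequel `KolyvaginStalkSystem.lean` proves the finite–singular relations (the SWAP identity of
  FILE C), `κ ∈ KS₁(M, 𝓕, 𝒫)`, `κ_n ≠ 0` at every core vertex, and the instance-free END statement of
  K4 `exists_isKolyvaginSystem_ne_zero_of_core`.

References: B. Mazur, K. Rubin, JTNB 28 (2016) 145–183 (arXiv:1312.4052) Def. 8.1, Lemma 8.2,
Prop. 8.3, Thm. 8.4 (read 2026-08-21, held); K. Rubin, PCMI 18 (2011) Def. 2.2.1, Cor. 2.8.9 (held).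
-/

noncomputable section

open scoped Classical NumberField ContRepresentation
open Function NumberField IsDedekindDomain
open Literature.NumberTheory.GaloisRepresentations Literature.NumberTheory.GaloisRepresentations.DiscreteGaloisModule
  Literature.NumberTheory.GaloisCohomology
open Summit.BirchSwinnertonDyer.Rank1Residual.GaloisImage.CoreRankZero
open Summit.BirchSwinnertonDyer.Rank1Residual.GaloisImage.VolumeForm

universe u

namespace Summit.BirchSwinnertonDyer.Rank1Residual.GaloisImage.CoreRankOne.Stalk

variable {K : Type u} [Field K] [NumberField K]
variable {M : Type u} [AddCommGroup M] [TopologicalSpace M] [DiscreteTopology M] [Finite M]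
variable {ρ : DiscreteGaloisModule K M} (p : ℕ) [Fact p.Prime] [Module (ZMod p) (galoisCohomology ρ 1)]

/-! ## §1. The slot families `φ_n` and the classes `κ_n` -/

section Kappa

variable (𝓕 : SelmerStructure ρ) [Finite 𝓕.selmerGroup] (D : KolyvaginDatum ρ)
  (N₀ : Finset (HeightOneSpectrum (𝓞 K)))
  (ε₀ : (Module.Dual (ZMod p) (galoisCohomology ρ 1)) [⋀^Option ↥N₀]→ₗ[ZMod p] ZMod p)

/-- The slot family of the level `n` read at the level `N`: `f_𝔮` at the primes of `n`, `t_𝔮` at the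
others (Mazur–Rubin Def. 8.1: `loc^f` at `𝔩 ∣ 𝔫`, `loc^tr` at `𝔩 ∣ 𝔫′/𝔫`). [folklore] -/
def phiFamily (n N : Finset (HeightOneSpectrum (𝓞 K))) : ↥N → Module.Dual (ZMod p) (galoisCohomology ρ 1) :=
  fun ℓ => if ℓ.1 ∈ n then fFun p D ℓ.1 else tFun ρ p ℓ.1

/-- **The classes `κ_n`**: `(−1)^{#n} · cross_{W(n ∪ N₀)} (vol (n ∪ N₀)) φ_n` at a level `n`, `0`
off the levels (Mazur–Rubin's `(−1)^{ν(𝔫)} Π_𝔫(ε_𝔫)`, Prop. 8.3, at rank one). [folklore] -/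
def kappa (n : Finset (HeightOneSpectrum (𝓞 K))) : galoisCohomology ρ 1 :=
  if D.IsLevel n then
    ((-1 : ℤ) ^ n.card) •
      ((cross (Wsub p 𝓕 (n ∪ N₀)) (vol p 𝓕 N₀ ε₀ (n ∪ N₀)) (phiFamily p D n (n ∪ N₀)) :
        Wsub p 𝓕 (n ∪ N₀)) : galoisCohomology ρ 1)
  else 0

variable {𝓕 D N₀ ε₀}

omit [Finite M] [Finite 𝓕.selmerGroup] in
/-- Unfolding `phiFamily` at a prime of `n`. [folklore] -/
theorem phiFamily_apply_of_mem {n N : Finset (HeightOneSpectrum (𝓞 K))} {ℓ : ↥N} (h : ℓ.1 ∈ n) :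
    phiFamily p D n N ℓ = fFun p D ℓ.1 := if_pos h

omit [Finite M] [Finite 𝓕.selmerGroup] in
/-- Unfolding `phiFamily` off `n`. [folklore] -/
theorem phiFamily_apply_of_not_mem {n N : Finset (HeightOneSpectrum (𝓞 K))} {ℓ : ↥N} (h : ℓ.1 ∉ n) :
    phiFamily p D n N ℓ = tFun ρ p ℓ.1 := if_neg h

omit [Finite M] [Finite 𝓕.selmerGroup] in
/-- Read at a bigger level `N′ ⊇ N ⊇ n`, the slot family is the old one extended by the frozen
transverse functionals. [folklore] -/
theorem extend_phiFamily {n N N' : Finset (HeightOneSpectrum (𝓞 K))} (hnN : n ⊆ N) (hNN' : N ⊆ N') :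
    Function.extend (levelIncl hNN') (phiFamily p D n N) (tFamily ρ p N') = phiFamily p D n N' := by
  funext b
  by_cases hb : b.1 ∈ N
  · have : b = levelIncl hNN' ⟨b.1, hb⟩ := Subtype.ext rfl
    rw [this, (levelIncl_injective hNN').extend_apply]
    rfl
  · rw [extend_apply' _ _ _ (fun ⟨x, hx⟩ => hb (by rw [← hx]; exact x.2)),
      phiFamily_apply_of_not_mem p (fun h => hb (hnN h))]

omit [Finite M] [Finite 𝓕.selmerGroup] in
/-- Adjoining `𝔮` to `n` updates the slot family at `𝔮` from `t_𝔮` to `f_𝔮`. [folklore] -/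
theorem phiFamily_insert {n N : Finset (HeightOneSpectrum (𝓞 K))} {q : HeightOneSpectrum (𝓞 K)}
    (hq : q ∈ N) :
    phiFamily p D (insert q n) N = update (phiFamily p D n N) ⟨q, hq⟩ (fFun p D q) := by
  funext b
  by_cases hb : b = ⟨q, hq⟩
  · subst hb
    rw [update_self, phiFamily_apply_of_mem p (Finset.mem_insert_self q n)]
  · have hbq : b.1 ≠ q := fun h => hb (Subtype.ext h)
    rw [update_of_ne hb]
    by_cases hbn : b.1 ∈ n
    · rw [phiFamily_apply_of_mem p hbn,
        phiFamily_apply_of_mem p (Finset.mem_insert_of_mem hbn)]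
    · rw [phiFamily_apply_of_not_mem p hbn, phiFamily_apply_of_not_mem p]
      simp [hbq, hbn]

/-- `κ_n = 0` off the levels. [folklore] -/
theorem kappa_of_not_isLevel {n : Finset (HeightOneSpectrum (𝓞 K))} (hn : ¬ D.IsLevel n) :
    kappa p 𝓕 D N₀ ε₀ n = 0 := if_neg hn

/-- Unfolding `κ_n` at a level. [folklore] -/
theorem kappa_of_isLevel {n : Finset (HeightOneSpectrum (𝓞 K))} (hn : D.IsLevel n) :
    kappa p 𝓕 D N₀ ε₀ n = ((-1 : ℤ) ^ n.card) •
      ((cross (Wsub p 𝓕 (n ∪ N₀)) (vol p 𝓕 N₀ ε₀ (n ∪ N₀)) (phiFamily p D n (n ∪ N₀)) :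
        Wsub p 𝓕 (n ∪ N₀)) : galoisCohomology ρ 1) := if_pos hn

end Kappa

/-! ## §2. The standing hypotheses and the levels `n ∪ N₀` -/

section Standing

variable {S : Finset (Place K)} {inv : LocalInvariants K p} {𝓕 : SelmerStructure ρ} {D : KolyvaginDatum ρ}
  {N₀ : Finset (HeightOneSpectrum (𝓞 K))}

omit [Finite M] [Module (ZMod p) (galoisCohomology ρ 1)] in
/-- `#H¹_{/ur}(K_𝔮, M) = p` at every Kolyvagin prime, from `hU` and `hH1`. [folklore] -/
theorem hSQ_of (hU : ∀ q ∈ D.primes, Nat.card (unramifiedSubgroup (GaloisRep.toLocal q ρ) 1) = p)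
    (hH1 : ∀ q ∈ D.primes, Nat.card (galoisCohomology (GaloisRep.toLocal q ρ) 1) = p ^ 2) :
    ∀ q ∈ D.primes, Nat.card (SingularQuotient (GaloisRep.toLocal q ρ)) = p :=
  fun q hq => natCard_singularQuotient_eq ρ p q (hU q hq) (hH1 q hq)

omit [Finite M] [Fact p.Prime] in
/-- `H¹_ur` and `H¹_tr` are complementary at every Kolyvagin prime, from `hUT` and `hUT′`. [folklore] -/
theorem isCompl_of (hUT : ∀ q ∈ D.primes,
      unramifiedSubgroup (GaloisRep.toLocal q ρ) 1 ⊔ D.transverse (Sum.inr q) = ⊤)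
    (hUT' : ∀ q ∈ D.primes, unramifiedSubgroup (GaloisRep.toLocal q ρ) 1 ⊓ D.transverse (Sum.inr q) = ⊥) :
    ∀ q ∈ D.primes, IsCompl (unramifiedSubgroup (GaloisRep.toLocal q ρ) 1)
      (D.transverse (Sum.inr q) : AddSubgroup (galoisCohomology (GaloisRep.toLocal q ρ) 1)) :=
  fun q hq => ⟨disjoint_iff.mpr (hUT' q hq), codisjoint_iff.mpr (hUT q hq)⟩

omit [Module (ZMod p) (galoisCohomology ρ 1)] in
/-- At core rank one, `#W(n ∪ N₀) = p^{#(n ∪ N₀)+1}` for every level `n` above a core-like base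
`N₀`. [folklore] -/
theorem natCard_relaxedAt_union (hperf : inv.IsPerfect) (hsum : inv.SumLocalTermEqZero)
    (hcompl : inv.SelmerComplement) (hM : ∀ m : M, p • m = 0)
    (hS : ∀ v : HeightOneSpectrum (𝓞 K), (Sum.inr v : Place K) ∉ S →
      ((p : ℕ) : 𝓞 K) ∉ v.asIdeal ∧ GaloisRep.IsUnramifiedAt v ρ)
    (h𝓕 : 𝓕.IsUnramifiedOutside S) (hfin : Finite 𝓕.selmerGroup)
    (hfind : Finite (inv.dualSelmerStructure ρ 𝓕).selmerGroup)
    (hχ : LocalInvariants.HasCoreRank inv 𝓕 p 1)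
    (hPS : ∀ q ∈ D.primes, (Sum.inr q : Place K) ∉ S)
    (hU : ∀ q ∈ D.primes, Nat.card (unramifiedSubgroup (GaloisRep.toLocal q ρ) 1) = p)
    (hH1 : ∀ q ∈ D.primes, Nat.card (galoisCohomology (GaloisRep.toLocal q ρ) 1) = p ^ 2)
    (hN₀ : D.IsLevel N₀) (hcore₀ : (inv.dualSelmerStructure ρ (𝓕.relaxedAt N₀)).selmerGroup = ⊥)
    {n : Finset (HeightOneSpectrum (𝓞 K))} (hn : D.IsLevel n) :
    Nat.card (𝓕.relaxedAt (n ∪ N₀)).selmerGroup = p ^ ((n ∪ N₀).card + 1) := by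
  have hlev : D.IsLevel (n ∪ N₀) := by
    intro x hx
    rcases Finset.mem_union.mp (Finset.mem_coe.mp hx) with h | h
    · exact hn h
    · exact hN₀ h
  rw [natCard_selmerGroup_relaxedAt_eq_pow_mul hperf hsum hcompl hM hS h𝓕 hfin hfind hχ hPS hU hH1 hlev,
    dualSelmerGroup_relaxedAt_eq_bot_mono inv 𝓕 Finset.subset_union_right hcore₀, AddSubgroup.card_bot,
    mul_one]

omit [Finite M] [Fact p.Prime] [Module (ZMod p) (galoisCohomology ρ 1)] in
/-- `n ∪ N₀` is a level. [folklore] -/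
theorem isLevel_union {n : Finset (HeightOneSpectrum (𝓞 K))} (hn : D.IsLevel n) (hN₀ : D.IsLevel N₀) :
    D.IsLevel (n ∪ N₀) := by
  intro x hx
  rcases Finset.mem_union.mp (Finset.mem_coe.mp hx) with h | h
  · exact hn h
  · exact hN₀ h

end Standing

/-! ## §3. `κ_n ∈ H¹_{𝓕(n)}(K, M)` -/

section Main

variable {S : Finset (Place K)} {inv : LocalInvariants K p} {𝓕 : SelmerStructure ρ} [Finite 𝓕.selmerGroup]
  {D : KolyvaginDatum ρ} {N₀ : Finset (HeightOneSpectrum (𝓞 K))}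
  {ε₀ : (Module.Dual (ZMod p) (galoisCohomology ρ 1)) [⋀^Option ↥N₀]→ₗ[ZMod p] ZMod p}

/-- The cross product defining `κ_n`, read at any core-like level `N ⊇ n ∪ N₀`... here at
`N = n ∪ N₀`: it lies in `H¹_{𝓕(n)}(K, M)` (killed by every slot functional, `apply_self_cross`,
then the kernel description of the stalk, FILE D1). [folklore] -/
theorem cross_mem_selmerGroup_atLevel
    (h𝓕 : 𝓕.IsUnramifiedOutside S) (hPS : ∀ q ∈ D.primes, (Sum.inr q : Place K) ∉ S)
    (hadm : D.IsAdmissible)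
    (hSQ : ∀ q ∈ D.primes, Nat.card (SingularQuotient (GaloisRep.toLocal q ρ)) = p)
    (hc : ∀ q ∈ D.primes, IsCompl (unramifiedSubgroup (GaloisRep.toLocal q ρ) 1)
      (D.transverse (Sum.inr q) : AddSubgroup (galoisCohomology (GaloisRep.toLocal q ρ) 1)))
    {n N : Finset (HeightOneSpectrum (𝓞 K))} (hnN : n ⊆ N) (hN : D.IsLevel N)
    {ω : (Module.Dual (ZMod p) (galoisCohomology ρ 1)) [⋀^Option ↥N]→ₗ[ZMod p] ZMod p}
    (hω : ω ∈ volOn (Option ↥N) (Wsub p 𝓕 N)) :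
    ((cross (Wsub p 𝓕 N) ω (phiFamily p D n N) : Wsub p 𝓕 N) : galoisCohomology ρ 1) ∈
      (D.atLevel 𝓕 n).selmerGroup := by
  rw [mem_selmerGroup_atLevel_iff_fFun_tFun p h𝓕 hPS hSQ hc hadm hnN hN (cross (Wsub p 𝓕 N) ω _).2]
  refine ⟨fun q hq => ?_, fun q hq hqn => ?_⟩
  · have h := apply_self_cross hω (phiFamily p D n N) ⟨q, hnN hq⟩
    rwa [phiFamily_apply_of_mem p (show (⟨q, hnN hq⟩ : ↥N).1 ∈ n from hq)] at h
  · have h := apply_self_cross hω (phiFamily p D n N) ⟨q, hq⟩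
    rwa [phiFamily_apply_of_not_mem p (show (⟨q, hq⟩ : ↥N).1 ∉ n from hqn)] at h

/-- **`κ_n ∈ H¹_{𝓕(n)}(K, M)` at every level `n`** (Mazur–Rubin Def. 8.1 / Prop. 8.3 (i), first
half). [folklore] -/
theorem kappa_mem_selmerGroup (hperf : inv.IsPerfect) (hsum : inv.SumLocalTermEqZero)
    (hcompl : inv.SelmerComplement) (hM : ∀ m : M, p • m = 0)
    (hS : ∀ v : HeightOneSpectrum (𝓞 K), (Sum.inr v : Place K) ∉ S →
      ((p : ℕ) : 𝓞 K) ∉ v.asIdeal ∧ GaloisRep.IsUnramifiedAt v ρ)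
    (h𝓕 : 𝓕.IsUnramifiedOutside S) (hfind : Finite (inv.dualSelmerStructure ρ 𝓕).selmerGroup)
    (hχ : LocalInvariants.HasCoreRank inv 𝓕 p 1)
    (hPS : ∀ q ∈ D.primes, (Sum.inr q : Place K) ∉ S) (hadm : D.IsAdmissible)
    (hU : ∀ q ∈ D.primes, Nat.card (unramifiedSubgroup (GaloisRep.toLocal q ρ) 1) = p)
    (hc : ∀ q ∈ D.primes, IsCompl (unramifiedSubgroup (GaloisRep.toLocal q ρ) 1)
      (D.transverse (Sum.inr q) : AddSubgroup (galoisCohomology (GaloisRep.toLocal q ρ) 1)))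
    (hH1 : ∀ q ∈ D.primes, Nat.card (galoisCohomology (GaloisRep.toLocal q ρ) 1) = p ^ 2)
    (hN₀ : D.IsLevel N₀) (hcore₀ : (inv.dualSelmerStructure ρ (𝓕.relaxedAt N₀)).selmerGroup = ⊥)
    (hε₀ : ε₀ ∈ volOn (Option ↥N₀) (Wsub p 𝓕 N₀))
    {n : Finset (HeightOneSpectrum (𝓞 K))} (hn : D.IsLevel n) :
    kappa p 𝓕 D N₀ ε₀ n ∈ (D.atLevel 𝓕 n).selmerGroup := by
  have hfin : Finite 𝓕.selmerGroup := inferInstance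
  rw [kappa_of_isLevel p hn]
  refine AddSubgroup.zsmul_mem _ ?_ _
  have hW₀ := natCard_selmerGroup_relaxedAt_eq_pow_mul hperf hsum hcompl hM hS h𝓕 hfin hfind hχ hPS hU hH1 hN₀
  rw [hcore₀, AddSubgroup.card_bot, mul_one] at hW₀
  have hW := natCard_relaxedAt_union p hperf hsum hcompl hM hS h𝓕 hfin hfind hχ hPS hU hH1 hN₀ hcore₀ hn
  exact cross_mem_selmerGroup_atLevel p h𝓕 hPS hadm (hSQ_of p hU hH1) hc Finset.subset_union_left
    (isLevel_union hn hN₀)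
    (vol_mem_volOn_and_contract_vol p h𝓕 hfin hPS (hSQ_of p hU hH1) hε₀ hW₀ Finset.subset_union_right
      (isLevel_union hn hN₀) hW).1

end Main

end Summit.BirchSwinnertonDyer.Rank1Residual.GaloisImage.CoreRankOne.Stalk

end
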